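import Summits.BirchSwinnertonDyer.BirchSwinnertonDyer.Theorems.GoldfeldAllTwistsTwoConverseTwinBirchTamagawa
import Summits.BirchSwinnertonDyer.BirchSwinnertonDyer.Theorems.GoldfeldAllTwistsTwoConverseTwinGenusPeriodsNegTwo
import HarnessLib

set_option linter.dupNamespace false -- `…BirchSwinnertonDyer.BirchSwinnertonDyer…` is the cell's namespace (D-0017)
set_option autoImplicit false

/-!
# LINE B49 — THEOREM B′ (family F2, `d_K = −8q`), local input (B1b′): `c₂ = 4` for the two `ℚ₂`-classes of the
# twists `49a1^{(−2q)}` — `c₂(X₀(49)^{(−8)}) = 4` (seat c3/c301's `W₃₁₃₆`) and the NEW certificate `c₂(49a1^{(−10)}) = 4`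

Cell `bsd-goldfeld`, seat `bsd-goldfeld-s1p-c301` (prover, gen 9); planner ruling g25 (cii), scope memo
`HOME/GENUS-THEOREM-B-PRIME.md` factor F9 (`c₂ = 4` on the whole family F2: `q ≡ 1 (8)` ⇒ `V′_q ≅ X₀(49)^{(−8)}` over `ℚ₂`,
`q ≡ 5 (8)` ⇒ `V′_q ≅ X₀(49)^{(−40)}` over `ℚ₂`, `V′_q = X₀(49)^{(−8q)}`). Support for item `stmt-BirchSwinnertonDyer-19140`
(twin″); Theses-free; theorems only. HONEST FRAMING: local arithmetic at `2` of two explicit curves and of an explicit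
family of models; nothing about `L`-values or BSD. The F1 twin of this file is `…TwinBirchLocalFive`.

WHAT IS PROVED.
* §1 `c₂(X₀(49)^{(−8)}) = 4` (`localTamagawaNumber_padic_cm7_quadraticTwist_neg_eight`): `X₀(49)^{(−8)} ≅ W₃₁₃₆ =
  [0, −42, 0, 448, 0]` over `ℚ` (`smul_cm7_quadraticTwist_neg_eight`, seat c301 gen 8 XIII) and `c₂(W₃₁₃₆) = 4`
  (`localTamagawaNumber_padic_W3136_two`, seat c301 gen 8 XII).
* §2 **`c₂(E₋₁₀) = 4`** for `E₋₁₀ = [0, −210, 0, 11200, 0]` (the two-torsion model of `49a1^{(−10)}`,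
  `(½, −20, 0, 0) • X₀(49)^{(−10)}`), by the argument of file XII / B1b: `E₋₁₀` is ALREADY an `Iₙ*` normal form over `ℤ₂`
  (`a₁ = a₃ = a₆ = 0`, `a₂ = −210 ∈ 𝔪 ∖ 𝔪²`, `a₄ = 11200 = 2⁶·175 ∈ 𝔪³`), minimal at `2` (Kraus: `2⁸ ∤ c₄ = 2⁶·2625`,
  `c₆/64 + 1 = −1322999 ≢ 0 (mod 4)`), and its three `ℚ₂`-points `T = (0,0)`, `g = (50, 400)` (a RATIONAL point:
  `50³ − 210·50² + 11200·50 = 160000 = 400²`) and `g + T = (224, −1792)` (slope `8`) reduce to the singular point, so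
  the index `[E₋₁₀(ℚ₂) : E₋₁₀,₀(ℚ₂)] ∈ {2, 4}` (`LocalIndex.index_mem_of_normalForm_Istar_succ`) is `4`.
* §3 `c₂(X₀(49)^{(−40)}) = 4` (`X₀(49)^{(−40)} = ⟨½,0,0,0⟩ • X₀(49)^{(−10)} ≅ E₋₁₀` over `ℚ`), and **`c₂(V′_q) = 4` for
  every odd prime `q`** with `q ≡ 1 (mod 4)` (`q ≡ 1 (8)`: `q ∈ ℤ₂ˣ²`; `q ≡ 5 (8)`: `5q ∈ ℤ₂ˣ²`, `−8q = (−40)·(s/5)²`;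
  file B1a's `localTamagawaNumber_padic_quadraticTwist_eq_of_sq`). Kit j273920 (PARI): `c₂ = 4`, Kodaira `I₈*` for all
  20 test primes of both classes, and for `d = −8, −40`.
References: [Silverman1994] IV.9.4 Step 7 and Table 4.1; [SilvermanAEC2009] VII.1.3(b), VII.6, X.5 Cor. 5.4;
[Kraus1989] Prop. 2; [Serre1973] II.3.3 Thm 4; [CremonaAlgorithms1997] Table 1 (N = 3136: `c₂ = 4`; N = 78400 = 3136·25,
curve `49a1^{(−10)}`: `c₂ = 4`).
-/

noncomputable section

open scoped Classical NumberField

open WeierstrassCurve IsDedekindDomain IsLocalRing Rat.HeightOneSpectrum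
  Literature.NumberTheory.EllipticCurves Literature.NumberTheory.EllipticCurves.ModularForms
  Literature.NumberTheory.QuadraticForms
  Summit.BirchSwinnertonDyer.BirchSwinnertonDyer.Rank2Observatory.Tate
  Summit.BirchSwinnertonDyer.BirchSwinnertonDyer.Rank2Observatory.RootNumber

namespace Summit.BirchSwinnertonDyer.BirchSwinnertonDyer.Theorems.GoldfeldGoodTwists

/-! ## §1 `c₂(X₀(49)^{(−8)}) = 4` from `W₃₁₃₆` -/

/-- **`c₂(X₀(49)^{(−8)}) = 4`** (Mathlib's `2`-adics): `(1, −16, 0, 0) • X₀(49)^{(−8)} = W₃₁₃₆` over `ℚ`, hence over `ℚ₂`,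
and `c₂(W₃₁₃₆) = 4` (seat c301 gen 8, file XII). [cite: Silverman1994, IV.9.4 Step 7 and Table 4.1]
[cite: CremonaAlgorithms1997, Table 1 (N = 3136)] -/
theorem localTamagawaNumber_padic_cm7_quadraticTwist_neg_eight :
    (haveI := cm7.isElliptic_quadraticTwist (show (-8 : ℚ) ≠ 0 by norm_num)
     ((cm7.quadraticTwist (-8)).baseChange ℚ_[2]).localTamagawaNumber ℤ_[2]) = 4 := by
  haveI := cm7.isElliptic_quadraticTwist (show (-8 : ℚ) ≠ 0 by norm_num)
  haveI := isElliptic_twoTorsionModel_neg_two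
  have e : (⟨0, -42, 0, 448, 0⟩ : WeierstrassCurve ℚ).baseChange ℚ_[2] =
      ((⟨1, -16, 0, 0⟩ : VariableChange ℚ).map (algebraMap ℚ ℚ_[2])) • (cm7.quadraticTwist (-8)).baseChange ℚ_[2] := by
    rw [← VariableChange.baseChange_smul_eq, smul_cm7_quadraticTwist_neg_eight]
  have h := localTamagawaNumber_padic_W3136_two
  rw [e, WeierstrassCurve.localTamagawaNumber_variableChange_holds ℤ_[2] ((cm7.quadraticTwist (-8)).baseChange ℚ_[2])] at h
  exact h

/-! ## §2 The certificate `c₂(E₋₁₀) = 4`, `E₋₁₀ = [0, −210, 0, 11200, 0] = two-torsion model of 49a1^{(−10)}` -/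

/-- The two-torsion change for `d = −10`: `(1/2, −20, 0, 0) • X₀(49)^{(−10)} = [0, −210, 0, 11200, 0]`.
[cite: SilvermanAEC2009, III.1 Table 3.1] -/
theorem twoTorsionChange_smul_cm7_quadraticTwist_neg_ten :
    (⟨(Units.mk0 (2 : ℚ) two_ne_zero)⁻¹, -20, 0, 0⟩ : VariableChange ℚ) • cm7.quadraticTwist (-10) =
      ⟨0, -210, 0, 11200, 0⟩ := by
  ext <;> simp [quadraticTwist, b₂, b₄, b₆, variableChange_a₁, variableChange_a₂,
    variableChange_a₃, variableChange_a₄, variableChange_a₆] <;> norm_num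

/-- `E₋₁₀ = [0, −210, 0, 11200, 0]` is elliptic. [folklore] -/
theorem isElliptic_twoTorsionModel_neg_ten : (⟨0, -210, 0, 11200, 0⟩ : WeierstrassCurve ℚ).IsElliptic := by
  haveI := cm7.isElliptic_quadraticTwist (show (-10 : ℚ) ≠ 0 by norm_num)
  rw [← twoTorsionChange_smul_cm7_quadraticTwist_neg_ten]; infer_instance

/-- `[0, −210, 0, 11200, 0] = ℤ-model ⊗ ℚ`. [folklore] -/
theorem twoTorsionModel_neg_ten_eq_baseChange :
    (⟨0, -210, 0, 11200, 0⟩ : WeierstrassCurve ℚ) = (⟨0, -210, 0, 11200, 0⟩ : WeierstrassCurve ℤ).baseChange ℚ := by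
  ext <;> simp [baseChange]

/-- Invariants of `[0, −210, 0, 11200, 0]`: `c₄ = 168000 = 2⁶·2625`, `c₆ = 64·(−1323000)`. [folklore] -/
theorem invariants_twoTorsionModel_neg_ten :
    (⟨0, -210, 0, 11200, 0⟩ : WeierstrassCurve ℤ).c₄ = 168000 ∧
      (⟨0, -210, 0, 11200, 0⟩ : WeierstrassCurve ℤ).c₆ = 64 * (-1323000) := by
  refine ⟨by decide, by decide⟩

/-- **`[0, −210, 0, 11200, 0]` is minimal at `2`** (Kraus: `2⁸ ∤ c₄ = 2⁶·2625`, `c₆/64 + 1 = −1322999 ≢ 0 (mod 4)`).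
[cite: Kraus1989, Prop. 2] -/
theorem isMinimalAt_twoTorsionModel_neg_ten_two (v : HeightOneSpectrum (𝓞 ℚ)) (hv : natGenerator v = 2) :
    ((⟨0, -210, 0, 11200, 0⟩ : WeierstrassCurve ℤ).baseChange ℚ).IsMinimalAt v := by
  obtain ⟨h4, h6⟩ := invariants_twoTorsionModel_neg_ten
  exact isMinimalAt_two_of_kraus_fails_int v hv _ (by rw [h4]; decide) h6 (by decide)

/-- `T = (0, 0) ∈ E₋₁₀(ℚ₂)`. [folklore] -/
theorem nonsingular_J10_zero_zero :
    ((⟨0, -210, 0, 11200, 0⟩ : WeierstrassCurve ℤ_[2]).baseChange ℚ_[2]).toAffine.Nonsingular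
      (algebraMap ℤ_[2] ℚ_[2] 0) (algebraMap ℤ_[2] ℚ_[2] 0) := by
  rw [Affine.nonsingular_iff', Affine.equation_iff']
  simp only [baseChange, toAffine, map_a₁, map_a₂, map_a₃, map_a₄, map_a₆, map_neg, map_ofNat, map_zero]
  norm_num

/-- `g = (50, 400) ∈ E₋₁₀(ℚ₂)` (a RATIONAL point: `50³ − 210·50² + 11200·50 = 160000 = 400²`). [folklore] -/
theorem nonsingular_J10_fifty :
    ((⟨0, -210, 0, 11200, 0⟩ : WeierstrassCurve ℤ_[2]).baseChange ℚ_[2]).toAffine.Nonsingular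
      (algebraMap ℤ_[2] ℚ_[2] 50) (algebraMap ℤ_[2] ℚ_[2] 400) := by
  rw [Affine.nonsingular_iff', Affine.equation_iff']
  simp only [baseChange, toAffine, map_a₁, map_a₂, map_a₃, map_a₄, map_a₆, map_neg, map_ofNat, map_zero]
  norm_num

/-- `g + T = (224, −1792) ∈ E₋₁₀(ℚ₂)` (`224·(224² − 210·224 + 11200) = 224·14336 = 1792²`). [folklore] -/
theorem nonsingular_J10_twoTwoFour :
    ((⟨0, -210, 0, 11200, 0⟩ : WeierstrassCurve ℤ_[2]).baseChange ℚ_[2]).toAffine.Nonsingular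
      (algebraMap ℤ_[2] ℚ_[2] 224) (algebraMap ℤ_[2] ℚ_[2] (-1792)) := by
  rw [Affine.nonsingular_iff', Affine.equation_iff']
  simp only [baseChange, toAffine, map_a₁, map_a₂, map_a₃, map_a₄, map_a₆, map_neg, map_ofNat, map_zero]
  norm_num

/-- **`g + T = (224, −1792)` in `E₋₁₀(ℚ₂)`** (slope `8`). [folklore] -/
theorem fifty_add_zeroZero_J10 :
    (Affine.Point.some _ _ nonsingular_J10_fifty :
        ((⟨0, -210, 0, 11200, 0⟩ : WeierstrassCurve ℤ_[2]).baseChange ℚ_[2]).toAffine.Point) +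
      Affine.Point.some _ _ nonsingular_J10_zero_zero =
      Affine.Point.some _ _ nonsingular_J10_twoTwoFour := by
  have hx : algebraMap ℤ_[2] ℚ_[2] 50 ≠ algebraMap ℤ_[2] ℚ_[2] 0 := by
    rw [map_ofNat, map_zero]; norm_num
  rw [Affine.Point.add_of_X_ne hx]
  refine point_some_congr ?_ ?_
  · rw [Affine.slope_of_X_ne hx]
    simp only [Affine.addX, baseChange, toAffine, map_a₁, map_a₂, map_neg, map_ofNat, map_zero]
    norm_num
  · rw [Affine.addY, Affine.negAddY, Affine.negY, Affine.slope_of_X_ne hx]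
    simp only [Affine.addX, baseChange, toAffine, map_a₁, map_a₂, map_a₃, map_neg, map_ofNat, map_zero]
    norm_num

/-- **`[E₋₁₀(ℚ₂) : E₋₁₀,₀(ℚ₂)] = 4`** (`Iₙ*` normal form, index `2` or `4`; the points `T`, `g`, `g + T` reduce to the
singular point). [cite: Silverman1994, IV.9.4 Step 7 and Table 4.1] -/
theorem index_nonsingularReductionSubgroup_J10 :
    ((⟨0, -210, 0, 11200, 0⟩ : WeierstrassCurve ℤ_[2]).nonsingularReductionSubgroup
      (integers_valuationRing_valuation ℤ_[2] ℚ_[2])).index = 4 := by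
  haveI : HenselianLocalRing ℤ_[2] :=
    { is_henselian := fun f hf a₀ h₁ h₂ =>
        HenselianRing.is_henselian (I := IsLocalRing.maximalIdeal ℤ_[2]) f hf a₀ h₁ (h₂.map _) }
  set H := (⟨0, -210, 0, 11200, 0⟩ : WeierstrassCurve ℤ_[2]).nonsingularReductionSubgroup
    (integers_valuationRing_valuation ℤ_[2] ℚ_[2]) with hH
  have hΔ : (⟨0, -210, 0, 11200, 0⟩ : WeierstrassCurve ℤ_[2]).Δ ≠ 0 := by
    simp only [WeierstrassCurve.Δ, b₂, b₄, b₆, b₈]; norm_num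
  have h1 : (⟨0, -210, 0, 11200, 0⟩ : WeierstrassCurve ℤ_[2]).a₁ ∈ maximalIdeal ℤ_[2] := by simp
  have h2 : (⟨0, -210, 0, 11200, 0⟩ : WeierstrassCurve ℤ_[2]).a₂ ∈ maximalIdeal ℤ_[2] := by
    have h := (intCast_mem_maximalIdeal_pow_padicInt_two_iff (-210) 1).mpr (by norm_num)
    rw [pow_one] at h; simpa using h
  have h2' : (⟨0, -210, 0, 11200, 0⟩ : WeierstrassCurve ℤ_[2]).a₂ ∉ maximalIdeal ℤ_[2] ^ 2 := by
    have h := (intCast_mem_maximalIdeal_pow_padicInt_two_iff (-210) 2).not.mpr (by norm_num)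
    simpa using h
  have h3 : (⟨0, -210, 0, 11200, 0⟩ : WeierstrassCurve ℤ_[2]).a₃ ∈ maximalIdeal ℤ_[2] ^ 2 := by simp
  have h4 : (⟨0, -210, 0, 11200, 0⟩ : WeierstrassCurve ℤ_[2]).a₄ ∈ maximalIdeal ℤ_[2] ^ 3 := by
    have h := (intCast_mem_maximalIdeal_pow_padicInt_two_iff 11200 3).mpr (by norm_num)
    simpa using h
  have h6 : (⟨0, -210, 0, 11200, 0⟩ : WeierstrassCurve ℤ_[2]).a₆ ∈ maximalIdeal ℤ_[2] ^ 4 := by simp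
  rcases LocalIndex.index_mem_of_normalForm_Istar_succ (K := ℚ_[2]) _ hΔ h1 h2 h2' h3 h4 h6 with h | h
  swap
  · exact h
  exfalso
  -- the three bad points
  have h3₁ : (⟨0, -210, 0, 11200, 0⟩ : WeierstrassCurve ℤ_[2]).a₃ ∈ maximalIdeal ℤ_[2] := by simp
  have h4₁ : (⟨0, -210, 0, 11200, 0⟩ : WeierstrassCurve ℤ_[2]).a₄ ∈ maximalIdeal ℤ_[2] := by
    simpa using natCast_mem_maximalIdeal_padicInt_two (n := 11200) (by norm_num)
  have h0 : (0 : ℤ_[2]) ∈ maximalIdeal ℤ_[2] := Ideal.zero_mem _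
  have h50 : (50 : ℤ_[2]) ∈ maximalIdeal ℤ_[2] := by
    simpa using natCast_mem_maximalIdeal_padicInt_two (n := 50) (by norm_num)
  have h400 : (400 : ℤ_[2]) ∈ maximalIdeal ℤ_[2] := by
    simpa using natCast_mem_maximalIdeal_padicInt_two (n := 400) (by norm_num)
  have h224 : (224 : ℤ_[2]) ∈ maximalIdeal ℤ_[2] := by
    simpa using natCast_mem_maximalIdeal_padicInt_two (n := 224) (by norm_num)
  have h1792 : (-1792 : ℤ_[2]) ∈ maximalIdeal ℤ_[2] := by
    have h := (intCast_mem_maximalIdeal_pow_padicInt_two_iff (-1792) 1).mpr (by norm_num)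
    rw [pow_one] at h; simpa using h
  have hT : (Affine.Point.some _ _ nonsingular_J10_zero_zero) ∉ H := fun hmem =>
    LocalIndex.not_hasNonsingularReduction_some _ h3₁ h4₁ h0 h0 nonsingular_J10_zero_zero
      ((mem_nonsingularReductionSubgroup_iff _).mp hmem)
  have hg : (Affine.Point.some _ _ nonsingular_J10_fifty) ∉ H := fun hmem =>
    LocalIndex.not_hasNonsingularReduction_some _ h3₁ h4₁ h50 h400 nonsingular_J10_fifty
      ((mem_nonsingularReductionSubgroup_iff _).mp hmem)
  have hgT : (Affine.Point.some _ _ nonsingular_J10_twoTwoFour) ∉ H := fun hmem =>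
    LocalIndex.not_hasNonsingularReduction_some _ h3₁ h4₁ h224 h1792 nonsingular_J10_twoTwoFour
      ((mem_nonsingularReductionSubgroup_iff _).mp hmem)
  -- index two: one non-trivial coset `· + a`
  obtain ⟨a, ha⟩ := AddSubgroup.index_eq_two_iff.mp h
  have key : ∀ P, P ∉ H → P + a ∈ H := fun P hP => by
    rcases ha P with ⟨h', -⟩ | ⟨h', -⟩
    · exact h'
    · exact (hP h').elim
  have ha' : a ∈ H := by
    have e : a = (Affine.Point.some _ _ nonsingular_J10_fifty + a) +
        (Affine.Point.some _ _ nonsingular_J10_zero_zero + a) -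
        (Affine.Point.some _ _ nonsingular_J10_twoTwoFour + a) := by
      rw [← fifty_add_zeroZero_J10]; abel
    rw [e]
    exact H.sub_mem (H.add_mem (key _ hg) (key _ hT)) (key _ hgT)
  rcases ha 0 with ⟨-, h'⟩ | ⟨-, h'⟩
  · exact h' H.zero_mem
  · exact h' (by rwa [zero_add])

/-- `E₋₁₀ ⊗ ℚ₂ = J₁₀ ⊗ ℚ₂` along the identity change, `J₁₀ = [0, −210, 0, 11200, 0]` over `ℤ₂`. [folklore] -/
theorem smul_E10_padic_two :
    (1 : VariableChange ℚ_[2]) • ((⟨0, -210, 0, 11200, 0⟩ : WeierstrassCurve ℚ).baseChange ℚ_[2]) =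
      (⟨0, -210, 0, 11200, 0⟩ : WeierstrassCurve ℤ_[2]).baseChange ℚ_[2] := by
  rw [one_smul]
  ext <;> simp only [baseChange, map_a₁, map_a₂, map_a₃, map_a₄, map_a₆, map_neg, map_ofNat, map_zero]

/-- `J₁₀ ⊗ ℚ₂` is a MINIMAL equation over `ℤ₂`. [cite: Kraus1989, Prop. 2] -/
theorem isMinimal_J10_padic_two :
    ((⟨0, -210, 0, 11200, 0⟩ : WeierstrassCurve ℤ_[2]).baseChange ℚ_[2]).IsMinimal ℤ_[2] := by
  set w₂ : HeightOneSpectrum (𝓞 ℚ) := (primesEquiv (R := 𝓞 ℚ)).symm ⟨2, Nat.prime_two⟩ with hw₂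
  have h2 : ((primesEquiv w₂ : Nat.Primes) : ℕ) = 2 := by rw [hw₂, Equiv.apply_symm_apply]
  have hgen : natGenerator w₂ = 2 := by
    rw [hw₂]; exact Literature.NumberTheory.GaloisRepresentations.Rat.natGenerator_primesEquiv_symm ⟨2, _⟩
  have hmin := isMinimalAt_twoTorsionModel_neg_ten_two w₂ hgen
  have hmin2 := (isMinimalAt_iff_isMinimal_padic w₂ 2 h2 _).mp hmin
  have e : ((⟨0, -210, 0, 11200, 0⟩ : WeierstrassCurve ℤ).baseChange ℚ).baseChange ℚ_[2] =
      (⟨0, -210, 0, 11200, 0⟩ : WeierstrassCurve ℤ_[2]).baseChange ℚ_[2] := by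
    ext <;> simp only [baseChange, map_a₁, map_a₂, map_a₃, map_a₄, map_a₆, map_neg, map_ofNat, map_zero]
  rw [← e]
  exact hmin2

/-- **`c₂(E₋₁₀) = 4`** (Mathlib's `2`-adics). [cite: Silverman1994, IV.9.4 Step 7 and Table 4.1]
[cite: CremonaAlgorithms1997, Table 1] -/
theorem localTamagawaNumber_padic_E10_two :
    (haveI := isElliptic_twoTorsionModel_neg_ten
     ((⟨0, -210, 0, 11200, 0⟩ : WeierstrassCurve ℚ).baseChange ℚ_[2]).localTamagawaNumber ℤ_[2]) = 4 := by
  haveI := isElliptic_twoTorsionModel_neg_ten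
  haveI := isMinimal_J10_padic_two
  rw [LocalIndex.localTamagawaNumber_eq_index_of_smul_eq_baseChange _ _ _ smul_E10_padic_two]
  exact index_nonsingularReductionSubgroup_J10

/-! ## §3 `c₂(X₀(49)^{(−40)}) = 4` and `c₂(V′_q) = 4` on both `ℚ₂`-classes -/

/-- `E₋₁₀ = C • X₀(49)^{(−40)}` over `ℚ` (`X₀(49)^{(−40)} = ⟨½,0,0,0⟩ • X₀(49)^{(−10)}`). [cite: SilvermanAEC2009, X.5 Cor. 5.4] -/
theorem smul_cm7_quadraticTwist_neg_forty_eq_E10 :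
    ((⟨(Units.mk0 (2 : ℚ) two_ne_zero)⁻¹, -20, 0, 0⟩ : VariableChange ℚ) *
        (⟨(Units.mk0 (2 : ℚ) two_ne_zero)⁻¹, 0, 0, 0⟩ : VariableChange ℚ)⁻¹) • cm7.quadraticTwist (-40) =
      (⟨0, -210, 0, 11200, 0⟩ : WeierstrassCurve ℚ) := by
  have h := quadraticTwist_cm7_four_mul (-10)
  rw [show ((4 * (-10 : ℤ) : ℤ) : ℚ) = -40 by norm_num, show ((-10 : ℤ) : ℚ) = -10 by norm_num] at h
  rw [mul_smul, h, inv_smul_smul]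
  exact twoTorsionChange_smul_cm7_quadraticTwist_neg_ten

/-- **`c₂(X₀(49)^{(−40)}) = 4`** (Mathlib's `2`-adics). [cite: Silverman1994, IV.9.4 Step 7 and Table 4.1] -/
theorem localTamagawaNumber_padic_cm7_quadraticTwist_neg_forty :
    (haveI := cm7.isElliptic_quadraticTwist (show (-40 : ℚ) ≠ 0 by norm_num)
     ((cm7.quadraticTwist (-40)).baseChange ℚ_[2]).localTamagawaNumber ℤ_[2]) = 4 := by
  haveI := cm7.isElliptic_quadraticTwist (show (-40 : ℚ) ≠ 0 by norm_num)
  haveI := isElliptic_twoTorsionModel_neg_ten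
  set C := ((⟨(Units.mk0 (2 : ℚ) two_ne_zero)⁻¹, -20, 0, 0⟩ : VariableChange ℚ) *
    (⟨(Units.mk0 (2 : ℚ) two_ne_zero)⁻¹, 0, 0, 0⟩ : VariableChange ℚ)⁻¹) with hC
  have e : (⟨0, -210, 0, 11200, 0⟩ : WeierstrassCurve ℚ).baseChange ℚ_[2] =
      (C.map (algebraMap ℚ ℚ_[2])) • (cm7.quadraticTwist (-40)).baseChange ℚ_[2] := by
    rw [← VariableChange.baseChange_smul_eq, smul_cm7_quadraticTwist_neg_forty_eq_E10]
  have h := localTamagawaNumber_padic_E10_two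
  rw [e, WeierstrassCurve.localTamagawaNumber_variableChange_holds ℤ_[2] ((cm7.quadraticTwist (-40)).baseChange ℚ_[2])] at h
  exact h

/-- **`c₂(V′_q) = 4`** for `V′_q = X₀(49)^{(−8q)}` and every prime `q ≡ 1 (mod 4)`: `q ≡ 1 (mod 8)` ⇒ `−8q = (−8)·θ²` in
`ℚ₂`, `c₂(V′_q) = c₂(X₀(49)^{(−8)}) = 4`; `q ≡ 5 (mod 8)` ⇒ `5q = s²`, `−8q = (−40)·(s/5)²`, `c₂(V′_q) = c₂(X₀(49)^{(−40)}) = 4`.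
[cite: Serre1973, Ch. II §3.3 Thm 4] [cite: Silverman1994, IV.9.4 Step 7 and Table 4.1] -/
theorem localTamagawaNumber_padic_twistEight_two {q : ℕ} (hq : q.Prime) (hq4 : q % 4 = 1) :
    (haveI := cm7.isElliptic_quadraticTwist (show (((-(8 * q) : ℤ)) : ℚ) ≠ 0 by
       have := hq.pos; exact_mod_cast (show (-(8 * (q : ℤ))) ≠ 0 by omega))
     ((cm7.quadraticTwist (((-(8 * q) : ℤ)) : ℚ)).baseChange ℚ_[2]).localTamagawaNumber ℤ_[2]) = 4 := by
  have hd : (((-(8 * q) : ℤ)) : ℚ) ≠ 0 := by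
    have := hq.pos; exact_mod_cast (show (-(8 * (q : ℤ))) ≠ 0 by omega)
  have hq0 : (q : ℚ_[2]) ≠ 0 := by exact_mod_cast hq.ne_zero
  have hcast : ((((-(8 * q) : ℤ)) : ℚ) : ℚ_[2]) = -8 * (q : ℚ_[2]) := by push_cast; ring
  rcases (show q % 8 = 1 ∨ q % 8 = 5 by omega) with h8 | h8
  · obtain ⟨s, hs⟩ := isSquare_padicInt_two_of_mod_eight h8
    have hθ : ((s : ℤ_[2]) : ℚ_[2]) ≠ 0 := by
      intro h0
      rw [PadicInt.coe_eq_zero] at h0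
      rw [h0, mul_zero] at hs
      exact hq.ne_zero (by exact_mod_cast hs)
    have h : ((((-(8 * q) : ℤ)) : ℚ) : ℚ_[2]) = ((-8 : ℚ) : ℚ_[2]) * ((s : ℤ_[2]) : ℚ_[2]) ^ 2 := by
      rw [hcast, sq, ← PadicInt.coe_mul, ← hs, PadicInt.coe_natCast]
      push_cast; ring
    rw [localTamagawaNumber_padic_quadraticTwist_eq_of_sq cm7 (by norm_num) hd hθ h]
    exact localTamagawaNumber_padic_cm7_quadraticTwist_neg_eight
  · obtain ⟨s, hs⟩ := isSquare_padicInt_two_of_mod_eight (n := 5 * q) (by omega)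
    have hθ : ((s : ℤ_[2]) : ℚ_[2]) / 5 ≠ 0 := by
      refine div_ne_zero (fun h0 => ?_) (by norm_num)
      rw [PadicInt.coe_eq_zero] at h0
      rw [h0, mul_zero] at hs
      have : (5 * q : ℕ) = 0 := by exact_mod_cast hs
      omega
    have h : ((((-(8 * q) : ℤ)) : ℚ) : ℚ_[2]) = ((-40 : ℚ) : ℚ_[2]) * (((s : ℤ_[2]) : ℚ_[2]) / 5) ^ 2 := by
      have hs' : ((5 * q : ℕ) : ℚ_[2]) = ((s : ℤ_[2]) : ℚ_[2]) * ((s : ℤ_[2]) : ℚ_[2]) := by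
        rw [← PadicInt.coe_mul, ← hs, PadicInt.coe_natCast]
      rw [hcast, div_pow, sq, ← hs']
      push_cast; ring
    rw [localTamagawaNumber_padic_quadraticTwist_eq_of_sq cm7 (by norm_num) hd hθ h]
    exact localTamagawaNumber_padic_cm7_quadraticTwist_neg_forty

end Summit.BirchSwinnertonDyer.BirchSwinnertonDyer.Theorems.GoldfeldGoodTwists

end
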